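import Literature.Topology.FourManifolds.CuspCubicInvariance
import HarnessLib

/-!
# Cusp-genericity at a point: the intrinsic condition and its invariance

Topic `Literature/Topology/FourManifolds` (programme of the fact
`Literature.Topology.FourManifolds.exists_isSimplifiedBrokenLefschetzFibration`, Baykur–Saeki 2017, §2.1:
generic maps `X⁴ → Σ²` have folds and cusps only).  The second-order genericity of
`OneOneTransversality.lean` is stated in charts (all `4 × 2` incidence systems have only
nondegenerate zeros); `OneOneSimpleCusp.lean` and `CuspCubicInvariance.lean` turned a
nondegenerate zero into the non-vanishing of the cubic `c₃ = ℓ D³g(k,k,k) + 3τ μ D²g(k,k)` and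
proved the cubic coordinate-independent.  Here the condition is packaged intrinsically, so that it
can be transported between the charts of a manifold:

* `OneJet.IsCuspGenericAt g x` — for a map to the plane: **at every cusp candidate datum
  `(ℓ, k)` at `x`** (cokernel covector `ℓ ≠ 0`, non-zero kernel vector `k` in the radical of the
  kernel Hessian) **and every multiplier datum `(μ, τ)`** (`ℓ D²g(x)(·, k) = -τ μ dg_x`) **the
  cubic `c₃(g; x, ℓ, μ, k, τ)` is non-zero** — Whitney's / Golubitsky–Guillemin's *simple cusp*
  condition (GG VI §2 Def. 2.3, p. 147) read before any normalisation of coordinates;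
* `OneJet.cubicForm_eq_of_multiplier` — the cubic does not depend on the multiplier datum
  (`D²g(k,k) ∈ Ker ℓ = Im dg_x` for a rank-one critical point into the plane);
* `OneJet.cubicForm_smul_smul` — homogeneity `c₃(νℓ, λk, τ') = ν λ³ c₃(ℓ, k, τ'/(νλ))`;
* **`OneJet.isCuspGenericAt_of_charts`** — chartwise nondegeneracy (the conclusion of
  `OneOneTransversality.ae_twoGeneric_quadPerturb` at `x`) + 1-jet transversality ⇒
  `IsCuspGenericAt g x`;
* `OneJet.IsCuspGenericAt.comp_source`, `OneJet.IsCuspGenericAt.comp_target` — **invariance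
  under local diffeomorphisms of source and target** (from `cubicForm_comp_source/target`).

Everything is proved; `IsCuspGenericAt` is the only definition; no named fact (D-0026).

## References

* M. Golubitsky, V. Guillemin, *Stable Mappings and Their Singularities*, GTM 14 (1973), Ch. VI
  §2, Def. 2.3, p. 147; §4–§5. [GolubitskyGuillemin1973]
* R. İ. Baykur, O. Saeki, *Simplifying indefinite fibrations on 4-manifolds*, arXiv:1705.11169,
  §2.1, p. 6. [BaykurSaeki2017]
-/

noncomputable section

set_option maxSynthPendingDepth 2

open Set Function Filter
open scoped ContDiff Topology

namespace Literature.Topology.FourManifolds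

namespace OneJet

section

/-- Local notation for this file: the model space `ℝⁿ = EuclideanSpace ℝ (Fin n)`. -/
local notation "𝔼 " n:arg => EuclideanSpace ℝ (Fin n)

variable {E E' : Type*} [NormedAddCommGroup E] [NormedSpace ℝ E] [NormedAddCommGroup E']
  [NormedSpace ℝ E']

/-- **Cusp-genericity of a map to the plane at a point** (intrinsic form of "every incidence
system of `S_{1,1}` has only nondegenerate zeros at `x`"): for every cokernel covector `ℓ ≠ 0`
(`ℓ ∘ dg_x = 0`), every non-zero kernel vector `k` in the radical of the kernel Hessian
(`ℓ D²g(x)(w, k) = 0` for `w ∈ Ker dg_x`) and every multiplier datum `(μ, τ)`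
(`ℓ D²g(x)(v, k) = -τ μ(dg_x v)` for all `v`), the cubic `c₃ = ℓ D³g(x)(k,k,k) + 3τ μ D²g(x)(k,k)`
is non-zero — the simple-cusp condition. [cite: GolubitskyGuillemin1973, Ch. VI §2, Def. 2.3; §4] -/
def IsCuspGenericAt (g : E → 𝔼 2) (x : E) : Prop :=
  ∀ ℓ : (𝔼 2) →L[ℝ] ℝ, ℓ ≠ 0 → ℓ.comp (fderiv ℝ g x) = 0 →
    ∀ k : E, k ≠ 0 → fderiv ℝ g x k = 0 →
      (∀ w, fderiv ℝ g x w = 0 → ℓ (fderiv ℝ (fderiv ℝ g) x w k) = 0) →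
        ∀ (μ : (𝔼 2) →L[ℝ] ℝ) (τ : ℝ),
          (∀ v, ℓ (fderiv ℝ (fderiv ℝ g) x v k) = -(τ * μ (fderiv ℝ g x v))) →
            cubicForm g x ℓ μ k τ ≠ 0

/-- Unfolding `IsCuspGenericAt`. [folklore] -/
theorem isCuspGenericAt_iff (g : E → 𝔼 2) (x : E) :
    IsCuspGenericAt g x ↔
      ∀ ℓ : (𝔼 2) →L[ℝ] ℝ, ℓ ≠ 0 → ℓ.comp (fderiv ℝ g x) = 0 →
        ∀ k : E, k ≠ 0 → fderiv ℝ g x k = 0 →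
          (∀ w, fderiv ℝ g x w = 0 → ℓ (fderiv ℝ (fderiv ℝ g) x w k) = 0) →
            ∀ (μ : (𝔼 2) →L[ℝ] ℝ) (τ : ℝ),
              (∀ v, ℓ (fderiv ℝ (fderiv ℝ g) x v k) = -(τ * μ (fderiv ℝ g x v))) →
                cubicForm g x ℓ μ k τ ≠ 0 :=
  Iff.rfl

/-! ### The cubic does not depend on the multiplier datum; homogeneity -/

/-- **Independence of the multiplier datum.**  At a rank-one critical point into the plane
(`dg_x ≠ 0`, cokernel covector `ℓ ≠ 0`) with kernel direction `k`, two multiplier data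
`(μ₁, τ₁)`, `(μ₂, τ₂)` give the same cubic: `D²g(k,k)` lies in `Ker ℓ = Im dg_x = ℝ dg_x e`, and
`τᵢ μᵢ(dg_x e) = -ℓ D²g(e, k)` for both. [folklore] -/
theorem cubicForm_eq_of_multiplier {g : E → 𝔼 2} {x : E} (hne : fderiv ℝ g x ≠ 0)
    {ℓ : (𝔼 2) →L[ℝ] ℝ} (hℓ : ℓ ≠ 0) (hℓg : ℓ.comp (fderiv ℝ g x) = 0) {k : E}
    (hk : fderiv ℝ g x k = 0) {μ₁ μ₂ : (𝔼 2) →L[ℝ] ℝ} {τ₁ τ₂ : ℝ}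
    (h₁ : ∀ v, ℓ (fderiv ℝ (fderiv ℝ g) x v k) = -(τ₁ * μ₁ (fderiv ℝ g x v)))
    (h₂ : ∀ v, ℓ (fderiv ℝ (fderiv ℝ g) x v k) = -(τ₂ * μ₂ (fderiv ℝ g x v))) :
    cubicForm g x ℓ μ₁ k τ₁ = cubicForm g x ℓ μ₂ k τ₂ := by
  have he : ∃ e, fderiv ℝ g x e ≠ 0 := by
    by_contra h
    push Not at h
    exact hne (ContinuousLinearMap.ext fun e => by simpa using h e)
  obtain ⟨e, he⟩ := he
  have hℓv : ∀ v, ℓ (fderiv ℝ g x v) = 0 := fun v => by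
    have := congrArg (fun φ : E →L[ℝ] ℝ => φ v) hℓg
    simpa using this
  have hq : ℓ (fderiv ℝ (fderiv ℝ g) x k k) = 0 := by rw [h₁ k, hk, map_zero, mul_zero, neg_zero]
  obtain ⟨s, hs⟩ := exists_eq_smul_of_apply_eq_zero hℓ (hℓv e) he hq
  rw [cubicForm_def, cubicForm_def, hs, map_smul, map_smul, smul_eq_mul, smul_eq_mul]
  have e1 := h₁ e
  have e2 := h₂ e
  linear_combination (3 * s) * (e1 - e2)

/-- **Homogeneity of the cubic**: `c₃(νℓ, μ, λk, τ') = ν λ³ c₃(ℓ, μ, k, τ'/(νλ))` (`ν, λ ≠ 0`).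
[folklore] -/
theorem cubicForm_smul_smul (g : E → 𝔼 2) (x : E) (ℓ μ : (𝔼 2) →L[ℝ] ℝ) (k : E) {ν lam : ℝ}
    (hν : ν ≠ 0) (hlam : lam ≠ 0) (τ' : ℝ) :
    cubicForm g x (ν • ℓ) μ (lam • k) τ' = ν * lam ^ 3 * cubicForm g x ℓ μ k (τ' / (ν * lam)) := by
  rw [cubicForm_def, cubicForm_def]
  simp only [map_smul, _root_.smul_apply, smul_eq_mul]
  field_simp

/-! ### Chartwise nondegeneracy implies cusp-genericity -/

/-- **Chartwise nondegenerate ⇒ cusp-generic.**  If `g : ℝ⁴ ⊇ Ω → ℝ²` (`C^∞`, `Ω` open) is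
1-jet-transverse at the rank-one critical point `x ∈ Ω` and every zero at `x` of each of the
`4 × 2` incidence systems of `S_{1,1}` is nondegenerate (the conclusion of
`OneOneTransversality.ae_twoGeneric_quadPerturb`), then `g` is cusp-generic at `x`.
[cite: GolubitskyGuillemin1973, Ch. VI §2, Def. 2.3; §5, Thm. 5.2] -/
theorem isCuspGenericAt_of_charts {g : 𝔼 4 → 𝔼 2} {Ω : Set (𝔼 4)} (hΩ : IsOpen Ω)
    (hg : ContDiffOn ℝ ∞ g Ω) {x : 𝔼 4} (hx : x ∈ Ω) (hne : fderiv ℝ g x ≠ 0)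
    (htr : IsOneJetTransverseAt g x)
    (hgen : ∀ a : Fin 4, ∀ i : Fin 2, ∀ (c : ℝ) (y : 𝔼 3) (τ : ℝ),
      oneOneSystem (EuclideanSpace.proj i) (EuclideanSpace.proj (i + 1)) a g (x, (c, (y, τ)))
          = 0 →
        Surjective (fderiv ℝ (oneOneSystem (EuclideanSpace.proj i)
          (EuclideanSpace.proj (i + 1)) a g) (x, (c, (y, τ))))) :
    IsCuspGenericAt g x := by
  intro ℓ hℓ hℓg k hk0 hkK hrad μ τ hrel
  obtain ⟨a, i, c, y, τ', ha, hy, hi, hc, h0, hc3⟩ :=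
    exists_chart_cuspCubic_ne_zero hΩ hg hx htr hgen hℓ hℓg hne hk0 hkK hrad
  set lam : ℝ := (k a)⁻¹ with hlam
  set ν : ℝ := (ℓ (EuclideanSpace.single i (1 : ℝ)))⁻¹ with hν
  have hlam0 : lam ≠ 0 := inv_ne_zero ha
  have hν0 : ν ≠ 0 := inv_ne_zero hi
  set ℓB : (𝔼 2) →L[ℝ] ℝ := EuclideanSpace.proj (i + 1) with hℓB
  -- the chart cubic, in terms of `(ℓ, k)`
  rw [cuspCubic_eq_cubicForm, hc, hy, cubicForm_smul_smul g x ℓ ℓB k hν0 hlam0] at hc3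
  have hc3' : cubicForm g x ℓ ℓB k (τ' / (ν * lam)) ≠ 0 := by
    intro h
    exact hc3 (by rw [h, mul_zero])
  -- the chart multiplier relation, in terms of `(ℓ, k)`
  obtain ⟨-, hZ2, -⟩ := (oneOneSystem_eq_zero_iff _ _ a g x c y τ').1 h0
  have hrel' : ∀ v, ℓ (fderiv ℝ (fderiv ℝ g) x v k) = -(τ' / (ν * lam) * ℓB (fderiv ℝ g x v)) := by
    intro v
    have h := hZ2 v
    rw [hc, hy] at h
    simp only [map_smul, _root_.smul_apply, smul_eq_mul] at h
    field_simp
    linear_combination h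
  rwa [cubicForm_eq_of_multiplier hne hℓ hℓg hkK hrel hrel']

/-! ### Invariance under local diffeomorphisms -/

/-- `2 ≤ ∞` in `WithTop ℕ∞`. [folklore] -/
private theorem two_le_infty'' : (2 : WithTop ℕ∞) ≤ ∞ := WithTop.coe_le_coe.2 le_top

/-- **Cusp-genericity is invariant under reparametrisation of the source** by a `C^∞` map with
invertible derivative at the point. [folklore] -/
theorem IsCuspGenericAt.comp_source {g : E → 𝔼 2} {Ω : Set E} (hΩ : IsOpen Ω)
    (hg : ContDiffOn ℝ ∞ g Ω) {σ : E' → E} {Ω' : Set E'} (hΩ' : IsOpen Ω')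
    (hσ : ContDiffOn ℝ ∞ σ Ω') (hσΩ : MapsTo σ Ω' Ω) {x' : E'} (hx' : x' ∈ Ω')
    {A : E' ≃L[ℝ] E} (hσd : HasFDerivAt σ (A : E' →L[ℝ] E) x')
    (h : IsCuspGenericAt g (σ x')) : IsCuspGenericAt (g ∘ σ) x' := by
  intro ℓ hℓ hℓg' k' hk'0 hk'K hrad' μ τ hrel'
  have hgd : DifferentiableAt ℝ g (σ x') :=
    (hg.contDiffAt (hΩ.mem_nhds (hσΩ hx'))).differentiableAt (by simp)
  have hfd : fderiv ℝ (g ∘ σ) x' = (fderiv ℝ g (σ x')).comp (A : E' →L[ℝ] E) := by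
    rw [fderiv_comp x' hgd hσd.differentiableAt, hσd.fderiv]
  have hg2 : ContDiffAt ℝ 2 g (σ x') := (hg.contDiffAt (hΩ.mem_nhds (hσΩ hx'))).of_le two_le_infty''
  have hσ2 : ContDiffAt ℝ 2 σ x' := (hσ.contDiffAt (hΩ'.mem_nhds hx')).of_le two_le_infty''
  have hD2 : ∀ v w, fderiv ℝ (fderiv ℝ (g ∘ σ)) x' v w =
      fderiv ℝ g (σ x') (fderiv ℝ (fderiv ℝ σ) x' v w) +
        fderiv ℝ (fderiv ℝ g) (σ x') (A v) (A w) := fun v w => by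
    rw [fderiv_fderiv_comp_apply_eq_add hg2 hσ2 v w, hσd.fderiv]
    rfl
  -- the data for `g` at `σ x'` with direction `k = A k'`
  have hℓg : ℓ.comp (fderiv ℝ g (σ x')) = 0 := by
    have : (ℓ.comp (fderiv ℝ (g ∘ σ) x')).comp (A.symm : E →L[ℝ] E') = 0 := by
      rw [hℓg', ContinuousLinearMap.zero_comp]
    rw [hfd, ContinuousLinearMap.comp_assoc, ContinuousLinearMap.comp_assoc] at this
    simpa using this
  have hℓv : ∀ w, ℓ (fderiv ℝ g (σ x') w) = 0 := fun w => by
    have := congrArg (fun φ : E →L[ℝ] ℝ => φ w) hℓg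
    simpa using this
  have hk0 : A k' ≠ 0 := fun h0 => hk'0 (A.injective (by rw [h0, map_zero]))
  have hkK : fderiv ℝ g (σ x') (A k') = 0 := by
    have := hk'K
    rwa [hfd] at this
  have hrad : ∀ w, fderiv ℝ g (σ x') w = 0 →
      ℓ (fderiv ℝ (fderiv ℝ g) (σ x') w (A k')) = 0 := by
    intro w hw
    have hw' : fderiv ℝ (g ∘ σ) x' (A.symm w) = 0 := by rw [hfd]; simp [hw]
    have h1 := hrad' (A.symm w) hw'
    rw [hD2, map_add, hℓv, zero_add] at h1
    simpa using h1
  have hrel : ∀ v, ℓ (fderiv ℝ (fderiv ℝ g) (σ x') v (A k')) =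
      -(τ * μ (fderiv ℝ g (σ x') v)) := by
    intro v
    have h1 := hrel' (A.symm v)
    rw [hD2, map_add, hℓv, zero_add, hfd] at h1
    simpa using h1
  have hmain := h ℓ hℓ hℓg (A k') hk0 hkK hrad μ τ hrel
  have hrelA : ∀ v, ℓ (fderiv ℝ (fderiv ℝ g) (σ x') v ((A : E' →L[ℝ] E) k')) =
      -(τ * μ (fderiv ℝ g (σ x') v)) := hrel
  rwa [cubicForm_comp_source hΩ hg hΩ' hσ hσΩ hx' hσd hℓg hrelA]

/-- **Cusp-genericity is invariant under local diffeomorphisms of the target.** [folklore] -/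
theorem IsCuspGenericAt.comp_target {g : E → 𝔼 2} {Ω : Set E} (hΩ : IsOpen Ω)
    (hg : ContDiffOn ℝ ∞ g Ω) {x : E} (hx : x ∈ Ω) {ψ : 𝔼 2 → 𝔼 2} {V : Set (𝔼 2)}
    (hV : IsOpen V) (hψ : ContDiffOn ℝ ∞ ψ V) (hgV : MapsTo g Ω V) {B : (𝔼 2) ≃L[ℝ] 𝔼 2}
    (hψd : HasFDerivAt ψ (B : (𝔼 2) →L[ℝ] 𝔼 2) (g x)) (h : IsCuspGenericAt g x) :
    IsCuspGenericAt (ψ ∘ g) x := by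
  intro ℓ' hℓ' hℓg' k hk0 hk' hrad' μ' τ hrel'
  have hgd : DifferentiableAt ℝ g x := (hg.contDiffAt (hΩ.mem_nhds hx)).differentiableAt (by simp)
  have hfd : fderiv ℝ (ψ ∘ g) x = (B : (𝔼 2) →L[ℝ] 𝔼 2).comp (fderiv ℝ g x) := by
    rw [fderiv_comp x hψd.differentiableAt hgd, hψd.fderiv]
  have hψ2 : ContDiffAt ℝ 2 ψ (g x) := (hψ.contDiffAt (hV.mem_nhds (hgV hx))).of_le two_le_infty''
  have hg2 : ContDiffAt ℝ 2 g x := (hg.contDiffAt (hΩ.mem_nhds hx)).of_le two_le_infty''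
  have hD2 : ∀ v w, fderiv ℝ (fderiv ℝ (ψ ∘ g)) x v w =
      B (fderiv ℝ (fderiv ℝ g) x v w) +
        fderiv ℝ (fderiv ℝ ψ) (g x) (fderiv ℝ g x v) (fderiv ℝ g x w) := fun v w => by
    rw [fderiv_fderiv_comp_apply_eq_add hψ2 hg2 v w, hψd.fderiv]
    rfl
  -- the data for `g` with covectors `ℓ' ∘ B`, `μ' ∘ B`
  set ℓ : (𝔼 2) →L[ℝ] ℝ := ℓ'.comp (B : (𝔼 2) →L[ℝ] 𝔼 2) with hℓdef
  have hℓ : ℓ ≠ 0 := by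
    intro h0
    apply hℓ'
    ext w
    have := congrArg (fun φ : (𝔼 2) →L[ℝ] ℝ => φ (B.symm w)) h0
    simpa [hℓdef] using this
  have hℓg : ℓ.comp (fderiv ℝ g x) = 0 := by
    rw [hℓdef, ContinuousLinearMap.comp_assoc, ← hfd, hℓg']
  have hk : fderiv ℝ g x k = 0 := by
    have := hk'
    rw [hfd] at this
    exact B.injective (by simpa using this)
  have hrad : ∀ w, fderiv ℝ g x w = 0 → ℓ (fderiv ℝ (fderiv ℝ g) x w k) = 0 := by
    intro w hw
    have hw' : fderiv ℝ (ψ ∘ g) x w = 0 := by rw [hfd]; simp [hw]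
    have h1 := hrad' w hw'
    rw [hD2, hw, map_zero, _root_.zero_apply, add_zero] at h1
    simpa [hℓdef] using h1
  have hrel : ∀ v, ℓ (fderiv ℝ (fderiv ℝ g) x v k) =
      -(τ * (μ'.comp (B : (𝔼 2) →L[ℝ] 𝔼 2)) (fderiv ℝ g x v)) := by
    intro v
    have h1 := hrel' v
    rw [hD2, hk, map_zero, add_zero, hfd] at h1
    simpa [hℓdef] using h1
  have hmain := h ℓ hℓ hℓg k hk0 hk hrad _ τ hrel
  rwa [cubicForm_comp_target hΩ hg hx hV hψ hgV hψd hk hℓg hrel]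

end

end OneJet

end Literature.Topology.FourManifolds
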